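import Literature.AnabelianGeometry.SemiGraphs.PSCVertexQuotientExistenceProofs
import Literature.AnabelianGeometry.SemiGraphs.PSCGraphicTransport
import Literature.AnabelianGeometry.SemiGraphs.PSCVertexQuotientConverseProofs
import Literature.AnabelianGeometry.SemiGraphs.PSCEdgewiseCriterionProofs
import HarnessLib

/-!
# [CombGC] Theorem 1.6 (ii): nodes of `G` force nodes of `H` (the node-existence input `hn`, derived)

Mochizuki, *A combinatorial version of the Grothendieck conjecture*, Tohoku Math. J. **59** (2007)
[CombGC], proof of Theorem 1.6 (ii), author's manuscript p. 14.  The cell's kernel of [IUTchI]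
Rmk. 1.2.3 (v) ("edge-wise filtration-preserving ⇒ group-theoretically edge-like",
`PSCEdgewiseCriterionProofs.lean`, abc-iut-w4-d052) carries a displayed hypothesis
`hn : Nonempty G.graph.N ↔ Nonempty H.graph.N` (print's "`n(G') = deg · n(G)`" bookkeeping at the
trivial covering); the typed statement of Thm. 1.6 (ii), `GraphicIffFiltrationPreservingHolds Ω`, has no
slot for it.  This proof-only file DERIVES it for noncuspidal sturdy data with `Σ = {l}` and a graphically
filtration-preserving `α`, from the sub-DAG's typed inputs BY NAME (cell file
`plan/L3/SUBDAG-CombGC-Thm16.md`, row T16-L10b, writer abc-iut-w4-d052):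

* `edgeFil_eq_of_isEmpty`, `cuspFil_eq_of_isEmpty` — a datum without nodes and cusps has
  `M^edge = M^cusp` (`= \overline{[U,U]}`) at every level; `map_cuspFil_of_isNoncuspidal` — for
  noncuspidal data `α` carries `M^cusp` to `M^cusp` (formal);
* `exists_level_edgeFil_ne_cuspFil` — a noncuspidal STURDY `G` WITH A NODE has a `Π^unr`-level `U` at
  which `M^edge_{G_U} ≠ M^cusp_{G_U}`: take `U = ⋂_v H_v`, `H_v` the kernels of the elementary abelian
  vertex quotients of [IUTchI] Rmk. 1.2.3 (iv) (abc-iut-w5-d174's existence theorem; they are proper by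
  "[nontrivial!]", abc-iut-w4-d052); then `i(G_U) ≤ (i(G)/2)·[Π:U] ≤ n(G)·[Π:U] = n(G_U)` (using
  `i(G) ≤ n(G) + 1`, `VertCountLeNodeCountSucc`), so `M_{G_U}/M^vert_{G_U}` has rank
  `n(G_U) + 1 − i(G_U) ≥ 1` (Rmk. 1.1.3, `AbelianizedGrphRank`), hence by Rmk. 1.3.1 (`DualityRankEq`,
  Prop. 1.3 for sturdy data) `M^edge_{G_U}/M^cusp_{G_U}` has positive rank and is nontrivial;
* `nonempty_nodes_of_isGraphicallyFiltrationPreserving` — hence, `α` being edge-wise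
  filtration-preserving, `H` has a node as soon as `G` has one; `nonempty_nodes_iff_of_inputs` — the
  displayed `hn`, from the inputs for `G` and for `H`.

Proof-only (0 defs); plain profinite group theory over the interface; nothing here takes a side on
[IUTchIII] Cor. 3.12. [cite: MochizukiCombGC2007, Thm 1.6(ii) p.14]
[cite: MochizukiCombGC2007, Rmk 1.3.1 p.10]
-/

noncomputable section

namespace Literature.AnabelianGeometry.SemiGraphs

namespace PSCDatum

open SemiGraphOfAnabelioids (IsProSigmaCompletion)

universe u

variable {P : Type u} [Group P] [TopologicalSpace P] [IsTopologicalGroup P]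

omit [TopologicalSpace P] [IsTopologicalGroup P] in
/-- A subgroup `V ⊇ [U, U]` is normal in `U` (as `V.subgroupOf U`). [folklore] -/
private theorem normal_subgroupOf_of_commutator_le' {U V : Subgroup P} (h : ⁅U, U⁆ ≤ V) :
    (V.subgroupOf U).Normal := by
  refine ⟨fun n hn g => ?_⟩
  rw [Subgroup.mem_subgroupOf] at hn ⊢
  have hc : (g : P) * n * (g : P)⁻¹ * (n : P)⁻¹ ∈ V :=
    h (Subgroup.commutator_mem_commutator g.2 n.2)
  simpa using V.mul_mem hc hn

/-! ### 1. Data without nodes and cusps -/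

omit [IsTopologicalGroup P] in
/-- A noncuspidal datum has no cusps. [cite: MochizukiCombGC2007, Def 1.1(i) p.6] -/
theorem isEmpty_cusps_of_isNoncuspidal (K : PSCDatum P) (h : K.graph.IsNoncuspidal) :
    IsEmpty K.graph.C :=
  Fintype.card_eq_zero_iff.mp h

/-- Without cusps, `M^cusp_{K_V} = \overline{[V, V]}` (the cuspidal family is empty).
[cite: MochizukiCombGC2007, Def 1.1(ii) p.7] -/
theorem cuspFil_eq_of_isEmpty (K : PSCDatum P) [IsEmpty K.graph.C] (V : Subgroup P) :
    K.cuspFil V = (⁅V, V⁆).topologicalClosure := by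
  haveI : IsEmpty {A : Subgroup P // K.IsCuspidalIn V A} :=
    ⟨fun ⟨_, _, ⟨c, _, _⟩, _⟩ => isEmptyElim c⟩
  unfold cuspFil
  rw [iSup_of_empty, sup_bot_eq]

/-- Without nodes and cusps, `M^edge_{K_V} = \overline{[V, V]}` (the edge-like family is empty).
[cite: MochizukiCombGC2007, Def 1.1(ii) p.7] -/
theorem edgeFil_eq_of_isEmpty (K : PSCDatum P) [IsEmpty K.graph.N] [IsEmpty K.graph.C]
    (V : Subgroup P) : K.edgeFil V = (⁅V, V⁆).topologicalClosure := by
  haveI : IsEmpty {A : Subgroup P // K.IsEdgeLikeIn V A} :=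
    ⟨fun ⟨_, _, hB, _⟩ => by
      rcases hB with ⟨e, _, _⟩ | ⟨c, _, _⟩
      · exact isEmptyElim e
      · exact isEmptyElim c⟩
  unfold edgeFil
  rw [iSup_of_empty, sup_bot_eq]

section Transport

variable {P' : Type u} [Group P'] [TopologicalSpace P'] [IsTopologicalGroup P']

/-- For NONCUSPIDAL data, `α` carries `M^cusp_{G_V} = \overline{[V,V]}` onto
`M^cusp_{H_{α V}} = \overline{[α V, α V]}` (formal). [cite: MochizukiCombGC2007, Def 1.4(iii) p.10] -/
theorem map_cuspFil_of_isNoncuspidal (G : PSCDatum P) (H : PSCDatum P') (α : P ≃ₜ* P')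
    (hG0 : G.graph.IsNoncuspidal) (hH0 : H.graph.IsNoncuspidal) (V : Subgroup P) :
    (G.cuspFil V).map α.toMulEquiv.toMonoidHom = H.cuspFil (V.map α.toMulEquiv.toMonoidHom) := by
  haveI := G.isEmpty_cusps_of_isNoncuspidal hG0
  haveI := H.isEmpty_cusps_of_isNoncuspidal hH0
  rw [G.cuspFil_eq_of_isEmpty, H.cuspFil_eq_of_isEmpty, map_topologicalClosure α,
    Subgroup.map_commutator]

end Transport

/-! ### 2. Pro-`Σ` completions of `ℤ^r`: trivial iff `r = 0` (what is needed of it) -/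

/-- A pro-`Σ` completion of `ℤ^r` with `r ≥ 1` (`l ∈ Σ` prime) in which every element is trivial
is absurd: it has a proper open subgroup. [cite: MochizukiCombGC2007, Rmk 1.3.1 p.10] -/
theorem false_of_forall_eq_one_of_completion {Sigma : Set ℕ} {Q : Type*} [Group Q]
    [TopologicalSpace Q] [IsTopologicalGroup Q] {r : ℕ} (hr : 0 < r)
    {ι : Multiplicative (Fin r → ℤ) →* Q} (hι : IsProSigmaCompletion Sigma ι) {l : ℕ} (hl : l.Prime)
    (hlS : l ∈ Sigma) (h1 : ∀ x : Q, x = 1) : False := by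
  obtain ⟨W, -, hW, -⟩ := exists_open_ne_top_pow_mem ⟨0, hr⟩ hι hl hlS
  exact hW (eq_top_iff.mpr fun x _ => by rw [h1 x]; exact W.one_mem)

/-- A pro-`Σ` completion of `ℤ^0` has only the trivial element in the closure of `1` — so if some
open subgroup is proper, the completion is not of `ℤ^0`: used in the form "two completions of the
same group, one of `ℤ^e` with `e ≥ 1`, the other of `ℤ^r`, force `r ≥ 1`".
[cite: MochizukiCombGC2007, Rmk 1.3.1 p.10] -/
theorem pos_of_completion_of_completion {Sigma : Set ℕ} {Q : Type*} [Group Q] [TopologicalSpace Q]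
    [IsTopologicalGroup Q] {e r : ℕ} (he : 0 < e) {ι : Multiplicative (Fin e → ℤ) →* Q}
    (hι : IsProSigmaCompletion Sigma ι) {ι' : Multiplicative (Fin r → ℤ) →* Q}
    (hι' : IsProSigmaCompletion Sigma ι') {l : ℕ} (hl : l.Prime) (hlS : l ∈ Sigma) : 0 < r := by
  rcases Nat.eq_zero_or_pos r with hr | hr
  · exfalso
    subst hr
    obtain ⟨W, hWo, hW, -⟩ := exists_open_ne_top_pow_mem ⟨0, he⟩ hι hl hlS
    apply hW
    -- the range of `ι'` is `{1}`, and it is dense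
    have hrange : Set.range ι' ⊆ (W : Set Q) := by
      rintro _ ⟨x, rfl⟩
      have hx : x = 1 := by
        have : Multiplicative.toAdd x = 0 := funext fun i => Fin.elim0 i
        rw [← ofAdd_toAdd x, this, ofAdd_zero]
      rw [hx, map_one]
      exact W.one_mem
    have hWc : IsClosed (W : Set Q) := Subgroup.isClosed_of_isOpen W hWo
    have hcl : closure (Set.range ι') ⊆ (W : Set Q) := hWc.closure_subset_iff.mpr hrange
    rw [hι'.dense.closure_eq] at hcl
    exact eq_top_iff.mpr fun x _ => hcl (Set.mem_univ x)
  · exact hr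

/-! ### 3. A level of a nodal sturdy datum at which `M^edge ≠ M^cusp` -/

section Level

variable [CompactSpace P] [T2Space P] (G : PSCDatum P)

omit [CompactSpace P] [T2Space P] in
/-- `Ker(Π_G ↠ Π^unr_G) ⊆ E^unr_G`. [cite: Mochizuki2012, IUTchI Rmk 1.2.3(iv) p.42] -/
theorem unrKer_le_unrAbKer : G.unrKer ≤ G.unrAbKer := by
  unfold unrAbKer
  exact le_sup_right.trans (Subgroup.le_topologicalClosure _)

/-- **A noncuspidal sturdy `G` WITH A NODE has a `Π^unr`-level at which `M^edge ≠ M^cusp`.**  Take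
`U = ⋂_v H_v` for the (proper, open, normal) kernels `H_v` of the elementary abelian vertex quotients
of [IUTchI] Rmk. 1.2.3 (iv); then `i(G_U) ≤ n(G_U)`, so `M_{G_U}/M^vert_{G_U}` has rank
`n(G_U) + 1 − i(G_U) ≥ 1` (Rmk. 1.1.3) and `M^edge_{G_U}/M^cusp_{G_U}` has the same positive rank
(Rmk. 1.3.1, sturdy). Inputs BY NAME: `UnrVerticialSplitInjection`, `UnrVertAbOfRank` (for the
kernels), `AbelianizedGrphRank`, `DualityRankEq`, `VertCountLeNodeCountSucc`.
[cite: MochizukiCombGC2007, Rmk 1.3.1 p.10] -/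
theorem exists_level_edgeFil_ne_cuspFil {l : ℕ} (hS : G.Sigma = {l}) (hGs : G.IsSturdy)
    (hsplit : G.UnrVerticialSplitInjection) (hrank : G.UnrVertAbOfRank)
    (hgrph : G.AbelianizedGrphRank) (hdual : G.DualityRankEq) (hconn : G.VertCountLeNodeCountSucc)
    (hN : Nonempty G.graph.N) :
    ∃ U : Subgroup P, IsOpen (U : Set P) ∧ G.edgeFil U ≠ G.cuspFil U := by
  have hlS : l ∈ G.Sigma := by rw [hS]; exact Set.mem_singleton l
  have hl : l.Prime := G.sigma_prime l hlS
  -- the kernels `H_v` of the elementary abelian vertex quotients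
  choose Hv hHv using fun v : G.graph.V =>
    G.exists_isElemAbUnrQuotient_inf_eq_vertexQuotientKer hsplit hrank hGs hl hlS v
  have hn' : ∀ v, (Hv v).Normal := fun v => (hHv v).1.1
  have ho' : ∀ v, IsOpen (Hv v : Set P) := fun v => (hHv v).1.2.1
  have hE' : ∀ v, G.unrAbKer ≤ Hv v := fun v => (hHv v).1.2.2.1
  -- `Π_v ⊔ H_v = ⊤` and `H_v ≠ ⊤`
  have hsup : ∀ v, G.vertGp v ⊔ Hv v = ⊤ := by
    intro v
    haveI := hn' v
    refine top_le_iff.mp ?_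
    have hWo : IsOpen ((G.vertGp v ⊔ Hv v : Subgroup P) : Set P) :=
      Subgroup.isOpen_mono le_sup_right (ho' v)
    have hKv : G.vertexQuotientKer l v ≤ Hv v := (hHv v).2.2 ▸ inf_le_right
    have hA : G.unrVertAb ≤ G.vertGp v ⊔ Hv v :=
      G.unrVertAb_le_of_forall_vertGp_le hWo ((hE' v).trans le_sup_right) fun w => by
        by_cases hwv : w = v
        · subst hwv; exact le_sup_left
        · exact ((G.vertGp_le_vertexQuotientKer l hwv).trans hKv).trans le_sup_right
    rw [← (hHv v).2.1]
    exact sup_le hA le_sup_right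
  have hne : ∀ v, Hv v ≠ ⊤ := by
    intro v h
    apply G.vertexQuotientKer_ne_unrVertAb hsplit hrank hGs hlS v
    rw [← (hHv v).2.2, h, inf_top_eq]
  -- the level `U := ⋂_v H_v`
  set U : Subgroup P := ⨅ v, Hv v with hU
  haveI hUn : U.Normal := Subgroup.normal_iInf_normal hn'
  have hUo : IsOpen (U : Set P) := by
    rw [hU, Subgroup.coe_iInf]
    exact isOpen_iInter_of_finite ho'
  haveI hUf : U.FiniteIndex := finiteIndex_of_isOpen U hUo
  have hKU : G.unrKer ≤ U := le_iInf fun v => G.unrKer_le_unrAbKer.trans (hE' v)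
  -- counting: `2 · [Π : U Π_v] ≤ [Π : U]` for every vertex
  have hidx : ∀ v, 2 * (U ⊔ G.vertGp v).index ≤ U.index := by
    intro v
    haveI := hn' v
    haveI : (Hv v).FiniteIndex := finiteIndex_of_isOpen _ (ho' v)
    have h1 : U.relIndex (U ⊔ G.vertGp v) * (U ⊔ G.vertGp v).index = U.index :=
      Subgroup.relIndex_mul_index le_sup_left
    have h2 : U.relIndex (U ⊔ G.vertGp v) = U.relIndex (G.vertGp v) :=
      Subgroup.relIndex_sup_left (G.vertGp v) U
    have h3 : (Hv v).relIndex (G.vertGp v) = (Hv v).index := by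
      rw [← Subgroup.relIndex_top_right, ← hsup v, Subgroup.relIndex_sup_right]
    have h4 : (Hv v).relIndex (G.vertGp v) ∣ U.relIndex (G.vertGp v) :=
      Subgroup.relIndex_dvd_of_le_left _ (iInf_le _ v)
    have h5 : U.relIndex (G.vertGp v) ≠ 0 := fun h0 =>
      hUf.index_ne_zero (Nat.eq_zero_of_zero_dvd (h0 ▸ Subgroup.relIndex_dvd_index_of_normal U _))
    have h6 : 2 ≤ U.relIndex (G.vertGp v) := by
      have hle := Nat.le_of_dvd (Nat.pos_of_ne_zero h5) h4
      rw [h3] at hle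
      have hH2 : 2 ≤ (Hv v).index := Subgroup.one_lt_index_of_ne_top (hne v)
      exact hH2.trans hle
    rw [← h1, h2]
    exact Nat.mul_le_mul_right _ h6
  -- hence `i(G_U) ≤ n(G_U)`
  have hi : G.graph.i ≤ G.graph.n + 1 := by
    have := hconn ⊤ (by rw [Subgroup.coe_top]; exact isOpen_univ)
    rwa [vertCount_top, nodeCount_top] at this
  have hn1 : 1 ≤ G.graph.n := Fintype.card_pos_iff.mpr hN
  have hcount : G.vertCount U ≤ G.nodeCount U := by
    rw [G.vertCount_eq_sum_index U, G.nodeCount_eq_of_isUnrCovering hKU]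
    have hsum : 2 * ∑ v, (U ⊔ G.vertGp v).index ≤ G.graph.i * U.index := by
      rw [Finset.mul_sum]
      calc ∑ v, 2 * (U ⊔ G.vertGp v).index
          ≤ ∑ _v : G.graph.V, U.index := Finset.sum_le_sum fun v _ => hidx v
        _ = G.graph.i * U.index := by rw [Finset.sum_const, Finset.card_univ, smul_eq_mul]; rfl
    have h2n : G.graph.i * U.index ≤ 2 * (G.graph.n * U.index) := by
      rw [← mul_assoc]
      exact Nat.mul_le_mul_right _ (by omega)
    exact Nat.le_of_mul_le_mul_left (hsum.trans h2n) two_pos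
  have he : 0 < G.nodeCount U + 1 - G.vertCount U := by omega
  -- the two pro-`Σ` completions at the level `U`
  have hUc : IsClosed (U : Set P) := Subgroup.isClosed_of_isOpen U hUo
  haveI : ((G.vertFil U).subgroupOf U).Normal :=
    normal_subgroupOf_of_commutator_le' ((G.commutator_le_cuspFil U).trans (G.cuspFil_le_vertFil U))
  haveI : ((G.cuspFil U).subgroupOf (G.edgeFil U)).Normal :=
    normal_subgroupOf_of_commutator_le'
      ((Subgroup.commutator_mono (G.edgeFil_le hUc) (G.edgeFil_le hUc)).trans
        (G.commutator_le_cuspFil U))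
  obtain ⟨ι, hι⟩ := hgrph U hUo
  obtain ⟨r, ι₁, ι₂, hι₁, hι₂⟩ := hdual hGs U hUo
  have hr : 0 < r := pos_of_completion_of_completion he hι hι₁ hl hlS
  refine ⟨U, hUo, fun heq => ?_⟩
  refine false_of_forall_eq_one_of_completion hr hι₂ hl hlS fun x => ?_
  obtain ⟨e, rfl⟩ := QuotientGroup.mk_surjective x
  rw [QuotientGroup.eq_one_iff, Subgroup.mem_subgroupOf, ← heq]
  exact e.2

end Level

/-! ### 4. Nodes of `G` force nodes of `H` -/

section Transfer

variable [CompactSpace P] [T2Space P]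
variable {P' : Type u} [Group P'] [TopologicalSpace P'] [IsTopologicalGroup P']
variable (G : PSCDatum P) (H : PSCDatum P') (α : P ≃ₜ* P')

/-- **Nodes of `G` force nodes of `H`** under an edge-wise filtration-preserving `α`, for noncuspidal
data with `G` sturdy and `Σ_G = {l}`: at the level `U` of `exists_level_edgeFil_ne_cuspFil`,
`M^edge_{G_U} ≠ M^cusp_{G_U}`, which `α` transports (edge-wise filtration preservation; `M^cusp =
\overline{[U,U]}` for noncuspidal data) — impossible if `H` had neither nodes nor cusps.
[cite: MochizukiCombGC2007, Thm 1.6(ii) p.14] -/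
theorem nonempty_nodes_of_isGraphicallyFiltrationPreserving {l : ℕ} (hS : G.Sigma = {l})
    (hGs : G.IsSturdy) (hG0 : G.graph.IsNoncuspidal) (hH0 : H.graph.IsNoncuspidal)
    (hsplit : G.UnrVerticialSplitInjection) (hrank : G.UnrVertAbOfRank)
    (hgrph : G.AbelianizedGrphRank) (hdual : G.DualityRankEq) (hconn : G.VertCountLeNodeCountSucc)
    (hα : G.IsEdgewiseFiltrationPreserving H α) (hN : Nonempty G.graph.N) :
    Nonempty H.graph.N := by
  by_contra hH
  haveI : IsEmpty H.graph.N := not_nonempty_iff.mp hH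
  haveI := H.isEmpty_cusps_of_isNoncuspidal hH0
  haveI := G.isEmpty_cusps_of_isNoncuspidal hG0
  obtain ⟨U, hUo, hne⟩ := G.exists_level_edgeFil_ne_cuspFil hS hGs hsplit hrank hgrph hdual hconn hN
  apply hne
  apply Subgroup.map_injective (f := α.toMulEquiv.toMonoidHom) α.injective
  rw [hα U hUo, H.edgeFil_eq_of_isEmpty, G.cuspFil_eq_of_isEmpty, map_topologicalClosure α,
    Subgroup.map_commutator]

/-- **The displayed node-existence input `hn` of the cell's Rmk.-1.2.3-(v) kernel, DERIVED** for
noncuspidal sturdy data with `Σ = {l}` on both sides and a graphically filtration-preserving `α`,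
from the typed inputs for `G` and for `H`. [cite: MochizukiCombGC2007, Thm 1.6(ii) p.14] -/
theorem nonempty_nodes_iff_of_inputs [CompactSpace P'] [T2Space P'] {l : ℕ} (hS : G.Sigma = {l})
    (hS' : H.Sigma = {l}) (hGs : G.IsSturdy) (hHs : H.IsSturdy) (hG0 : G.graph.IsNoncuspidal)
    (hH0 : H.graph.IsNoncuspidal)
    (hsplitG : G.UnrVerticialSplitInjection) (hrankG : G.UnrVertAbOfRank)
    (hgrphG : G.AbelianizedGrphRank) (hdualG : G.DualityRankEq) (hconnG : G.VertCountLeNodeCountSucc)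
    (hsplitH : H.UnrVerticialSplitInjection) (hrankH : H.UnrVertAbOfRank)
    (hgrphH : H.AbelianizedGrphRank) (hdualH : H.DualityRankEq) (hconnH : H.VertCountLeNodeCountSucc)
    (hα : G.IsGraphicallyFiltrationPreserving H α) :
    Nonempty G.graph.N ↔ Nonempty H.graph.N :=
  ⟨G.nonempty_nodes_of_isGraphicallyFiltrationPreserving H α hS hGs hG0 hH0 hsplitG hrankG hgrphG
      hdualG hconnG hα.2,
    H.nonempty_nodes_of_isGraphicallyFiltrationPreserving G α.symm hS' hHs hH0 hG0 hsplitH hrankH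
      hgrphH hdualH hconnH hα.2.symm⟩

end Transfer


end PSCDatum

end Literature.AnabelianGeometry.SemiGraphs

end
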